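import Summits.ValiantsHypothesis.ValiantsHypothesis.Theses.SummationBits
import Summits.ValiantsHypothesis.ValiantsHypothesis.Theorems.SummationBitsRyserOptimalDepth3StubFlatteningRegime
import Summits.ValiantsHypothesis.ValiantsHypothesis.Theorems.SummationBitsRyserOptimalDepth3StubEsymNormalForm
import Summits.ValiantsHypothesis.ValiantsHypothesis.Theorems.SummationBitsRyserOptimalDepth3EsymFlattening
import Summits.ValiantsHypothesis.ValiantsHypothesis.Theorems.SummationBitsRyserOptimalDepth3GradedNormalForm
import Summits.ValiantsHypothesis.ValiantsHypothesis.Theorems.SummationBitsRyserOptimalDepth3EsymToAffine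

/-!
# Line `registered` for crux `SummationBits.RyserOptimalDepth3` (stmt-ValiantsHypothesis-7565) — skeleton, lead c1 (cycle 2)

**Status (prover-line-stmt-ValiantsHypothesis-7565-c1-0, 2026-08-17).**  One registered stub, the GRADED heart
`stub_gradedHighDegree` (reshaped this cycle from lead -0's degree-`n`-only heart `stub_esymHighDegree`).
Everything else in the composition is a LANDED theorem: F `stub_flatteningRegime` (p147725), the graded
elementary-symmetric normal form `GradedNormalForm.graded_esymNormalForm` (p150640; the degree-`n` member is
stub N `stub_esymNormalForm`, p147416).  `RyserOptimalDepth3_of : Sig.stub_gradedHighDegree → …RyserOptimalDepth3`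
is sorry-free, and so is the converse `RyserOptimalDepth3_imp_gradedHighDegree` (§3): THE REGISTERED STUB IS
EQUIVALENT TO THE CRUX (also landed as `Theorems/SummationBitsRyserOptimalDepth3GradedHeart.lean`,
`GradedHeart.ryserOptimalDepth3_iff_gradedHighDegree` / `…_iff_gradedBound`).  The old heart H implies the new
one (`gradedHighDegree_of_esymHighDegree`, §2b), so a proof of H still closes the line
(`RyserOptimalDepth3_of (gradedHighDegree_of_esymHighDegree hH)`); H itself is one factor
`D + 1` stronger than the crux (`ryserOptimal_imp_esymBound`, p150667) and stays recorded as an attack surface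
for the disprover only.

Why reshape.  A line whose single open stub is strictly stronger than its crux can die (to an e-representation
of `per_n` with `r = 2^(αn)`, `D = 2^(βn)`, `α + β < 1 ≤ α + 2β`) without the crux being touched; the graded
stub cannot: any witness against it is a witness against `RyserOptimalDepth3` (`GradedNormalForm.affine_of_gradedESym`
keeps `(r, D)`), and any proof of it is a proof of the crux.  The line is therefore exactly as alive as the crux.

Honest size of the heart.  In either form the heart is an exponential (`2^n/poly(n)`) lower bound for affine
ΣΠΣ expressions of `per_n` over `ℂ` at super-linear degree (Shpilka's graded symmetric model of depth three);
by the depth-3 chasm (GKKS 2016 / Tavenas 2015, vendored `Literature…DepthThreeChasm`) it would force general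
arithmetic circuits for `per_n` of size `2^(Ω(n / log² n))` — far beyond `VP ≠ VNP`; the unconditional records
are polynomial (Shpilka–Wigderson 2001) resp. `n^(Ω(√log n))`-type (Limaye–Srinivasan–Tavenas 2021).  What is
PROVED in the heart's own model (p150629, `Theorems/…EsymFlattening.lean`): `binom(n,k)² ≤ r·binom(D,n−k)` for
every e-representation and every `k`; hence the heart's conclusion for `D ≤ n + t⌊log₂(n+2)⌋`
(`EsymFlattening.esym_lowDegree`), `4^n ≤ (n+1)²·r·binom(D,⌈n/2⌉)` always, and nothing of size `2^n/poly`
once `D ≥ n + ω(log n)` — the exact frontier of flattenings.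

## The crux

Route `route-ValiantsHypothesis-SummationBits`, crux rank 3 (route decl
`Summit.ValiantsHypothesis.ValiantsHypothesis.Theses.SummationBits.RyserOptimalDepth3`): there is `c` such that
for all `n ≥ 1` every affine depth-three expression `per_n = Σ_{i<r} Π_{j<D} ℓ_ij` (`ℓ_ij ∈ ℂ[x]`, total
degree `≤ 1`) has `2^n ≤ r·(D+1)·(n+2)^c` — Ryser/Glynn (`r = 2^n − 1`, resp. `2^(n-1)`, `D = n`) are optimal
up to `poly(n)`.

## Line `registered` — degree dial: flattening regime + graded elementary-symmetric normal form + the heart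

* **F `stub_flatteningRegime`** (LANDED p147725).  For every `t` some `c(t)`: if `D ≤ n + t·⌊log₂(n+2)⌋` then
  `2^n ≤ r (D+1) (n+2)^c` (partial derivatives of order `⌊n/2⌋`: `binom(n,k)² ≤ r·binom(D,k) ≤ r·2^(D−n)·binom(n,k)`).
* **G graded normal form** (LANDED p150640, `GradedNormalForm.graded_esymNormalForm`; its degree-`n` member is
  stub N, p147416).  An affine expression with parameters `(r, D)` yields a point `u ∈ ℂ^(n×n)`, scalars `a_i`
  and LINEAR forms `m_ij` with `Σ_i a_i · e_k(m_i1, …, m_iD) = [per_n(x+u)]_k` for EVERY `k` — same `r`, same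
  `D` (generic translation, division by the constant terms, homogeneous components; `[per_n(x+u)]_n = per_n`).
  Conversely (`GradedNormalForm.affine_of_gradedESym`) such a graded e-system gives back an affine expression
  with the same `(r, D)`.
* **Heart `stub_gradedHighDegree`** (OPEN, registered, lead).  For some `t, c`: every graded e-system for
  `per_n` in `D > n + t⌊log₂(n+2)⌋` linear forms has `2^n ≤ r (D+1) (n+2)^c`.

Composition `RyserOptimalDepth3_of` (sorry-free): take `t, c₁` from the heart and `c₂ = c(t)` from F; given an
affine expression, if `D ≤ n + t⌊log₂(n+2)⌋` apply F, else pass to the graded normal form (G) and apply the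
heart; exponent `c₁ + c₂`.  Converse `RyserOptimalDepth3_imp_gradedHighDegree` (sorry-free): G⁻¹
(`affine_of_gradedESym`) + the crux, `t = 0`.

Disproof used: none exists for this crux (`ledger crux ls stmt-ValiantsHypothesis-7565`, 2026-08-17: Lines/birth.*,
Lines/registered.*, Lines/registered-lead-c1.md, PICKED.md; no `Disproof.lean`, no `Negative/`).

Shape (skeleton audit by-name rule): §1 the stub statements as named Props `Sig.stub_*` · §2 the ONE registered
sorried stub `stub_gradedHighDegree` (`sorry` lives only there) · §2b recorded implications and landed sub-goals ·
§3 `RyserOptimalDepth3_of` (hypothesis = the `Sig` Prop, conclusion = the route decl BY NAME), the hypothesis-free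
`RyserOptimalDepth3_proof`, and the converse.
-/

set_option linter.dupNamespace false

namespace Summit.ValiantsHypothesis.ValiantsHypothesis.Cruxes.RyserOptimalDepth3.Registered

open MvPolynomial
open Literature.Computability.AlgebraicComplexity
open Summit.ValiantsHypothesis.ValiantsHypothesis.Theorems.SummationBitsRyserOptimalDepth3
open scoped BigOperators

/-! ## §1 The stub statements as named propositions -/

namespace Sig

/-- **Stub F** — the flattening regime `D ≤ n + t⌊log₂(n+2)⌋` (LANDED p147725). -/
def stub_flatteningRegime : Prop :=
  ∀ t : ℕ, ∃ c : ℕ, ∀ n : ℕ, 1 ≤ n →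
    ∀ (r D : ℕ) (ℓ : Fin r → Fin D → MvPolynomial (Fin n × Fin n) ℂ),
      (∀ i j, (ℓ i j).totalDegree ≤ 1) → (∑ i, ∏ j, ℓ i j) = perPoly (Fin n) ℂ →
        D ≤ n + t * Nat.log 2 (n + 2) → 2 ^ n ≤ r * (D + 1) * (n + 2) ^ c

/-- **G** — graded elementary-symmetric normal form (LANDED p150640): an affine expression with parameters
`(r, D)` gives a graded e-system `Σ_i a_i e_k(m_i) = [per_n(x+u)]_k` (all `k`) with the same `(r, D)`. -/
def gradedNormalForm : Prop :=
  ∀ n r D : ℕ, ∀ (ℓ : Fin r → Fin D → MvPolynomial (Fin n × Fin n) ℂ),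
    (∀ i j, (ℓ i j).totalDegree ≤ 1) → (∑ i, ∏ j, ℓ i j) = perPoly (Fin n) ℂ →
      ∃ (u : Fin n × Fin n → ℂ) (a : Fin r → ℂ) (m : Fin r → Fin D → MvPolynomial (Fin n × Fin n) ℂ),
        (∀ i j, (m i j).IsHomogeneous 1) ∧
          ∀ k : ℕ, (∑ i, C (a i) * aeval (m i) (esymm (Fin D) ℂ k)) =
            homogeneousComponent k (aeval (fun v => X v + C (u v)) (perPoly (Fin n) ℂ))

/-- **The heart (registered, OPEN)** — GRADED high-degree bound: for some `t, c`, every graded e-system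
`Σ_i a_i e_k(m_i1, …, m_iD) = [per_n(x+u)]_k` (all `k`; `m_ij` linear) with `D > n + t⌊log₂(n+2)⌋` has
`2^n ≤ r (D+1) (n+2)^c`.  Equivalent to the crux (§3). -/
def stub_gradedHighDegree : Prop :=
  ∃ t c : ℕ, ∀ n : ℕ, 1 ≤ n →
    ∀ (r D : ℕ) (u : Fin n × Fin n → ℂ) (a : Fin r → ℂ)
      (m : Fin r → Fin D → MvPolynomial (Fin n × Fin n) ℂ),
      (∀ i j, (m i j).IsHomogeneous 1) →
        (∀ k : ℕ, (∑ i, C (a i) * aeval (m i) (esymm (Fin D) ℂ k)) =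
          homogeneousComponent k (aeval (fun v => X v + C (u v)) (perPoly (Fin n) ℂ))) →
          n + t * Nat.log 2 (n + 2) < D → 2 ^ n ≤ r * (D + 1) * (n + 2) ^ c

/-- **Old heart H** (lead -0's registered stub, now a recorded SUFFICIENT condition only): the degree-`n`-only
bound, one factor `D + 1` stronger than the crux. -/
def stub_esymHighDegree : Prop :=
  ∃ t c : ℕ, ∀ n : ℕ, 1 ≤ n →
    ∀ (r D : ℕ) (a : Fin r → ℂ) (m : Fin r → Fin D → MvPolynomial (Fin n × Fin n) ℂ),
      (∀ i j, (m i j).IsHomogeneous 1) →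
        (∑ i, C (a i) * aeval (m i) (esymm (Fin D) ℂ n)) = perPoly (Fin n) ℂ →
          n + t * Nat.log 2 (n + 2) < D → 2 ^ n ≤ r * (D + 1) * (n + 2) ^ c

end Sig

/-! ## §1b The landed ingredients under their `Sig` names (no `sorry`) -/

/-- F holds (p147725). [cite: NisanWigderson1996, §3] -/
theorem stub_flatteningRegime_holds : Sig.stub_flatteningRegime :=
  Summit.ValiantsHypothesis.ValiantsHypothesis.Theorems.SummationBitsRyserOptimalDepth3.stub_flatteningRegime

/-- G holds (p150640). [cite: Shpilka2002, symmetric model of depth three] -/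
theorem gradedNormalForm_holds : Sig.gradedNormalForm :=
  fun _n _r _D ℓ hℓ hsum => GradedNormalForm.graded_esymNormalForm ℓ hℓ hsum

/-! ## §2 The registered stub (statement spelled out; the ONLY `sorry` of the file) -/

/-- **Heart (registered) — GRADED HIGH-DEGREE BOUND** (open; lead): there are `t, c` such that for all
`n ≥ 1`, every graded e-system `Σ_{i<r} a_i e_k(m_i1, …, m_iD) = [per_n(x+u)]_k` (all `k`) with linear
forms `m_ij` and `D > n + t⌊log₂(n+2)⌋` has `2^n ≤ r (D+1) (n+2)^c`.  EQUIVALENT to the crux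
(`RyserOptimalDepth3_of` / `RyserOptimalDepth3_imp_gradedHighDegree`).  Known: flattenings give the
conclusion for `D ≤ n + O(log n)` (`EsymFlattening.esym_lowDegree`) and only `r ≥ 2^(Θ(n²/D))` beyond;
unconditionally only polynomial / `n^(Ω(√log n))`-type bounds are known for affine ΣΠΣ over `ℂ`.
[cite: NisanWigderson1996] [cite: ShpilkaWigderson2001] [cite: Shpilka2002] [cite: Glynn2010] -/
theorem stub_gradedHighDegree :
    ∃ t c : ℕ, ∀ n : ℕ, 1 ≤ n →
      ∀ (r D : ℕ) (u : Fin n × Fin n → ℂ) (a : Fin r → ℂ)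
        (m : Fin r → Fin D → MvPolynomial (Fin n × Fin n) ℂ),
        (∀ i j, (m i j).IsHomogeneous 1) →
          (∀ k : ℕ, (∑ i, C (a i) * aeval (m i) (esymm (Fin D) ℂ k)) =
            homogeneousComponent k (aeval (fun v => X v + C (u v)) (perPoly (Fin n) ℂ))) →
            n + t * Nat.log 2 (n + 2) < D → 2 ^ n ≤ r * (D + 1) * (n + 2) ^ c := by
  sorry

/-! ## §2b Recorded implications around the heart (all sorry-free) -/

/-- The old heart H implies the graded heart: specialise the graded system at `k = n`
(`[per_n(x+u)]_n = per_n`). [folklore] -/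
theorem gradedHighDegree_of_esymHighDegree (h : Sig.stub_esymHighDegree) : Sig.stub_gradedHighDegree := by
  obtain ⟨t, c, hH⟩ := h
  refine ⟨t, c, fun n hn r D u a m hm hk hD => hH n hn r D a m hm ?_ hD⟩
  rw [hk n, StubEsymNormalForm.homogeneousComponent_translate_perPoly]

/-- The crux implies H up to one factor `D + 1` (Ben-Or interpolation, p150667). [folklore] -/
theorem esymBound_of_ryserOptimal
    (h : Summit.ValiantsHypothesis.ValiantsHypothesis.Theses.SummationBits.RyserOptimalDepth3) :
    ∃ c : ℕ, ∀ n : ℕ, 1 ≤ n →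
      ∀ (r D : ℕ) (a : Fin r → ℂ) (m : Fin r → Fin D → MvPolynomial (Fin n × Fin n) ℂ),
        (∀ i j, (m i j).IsHomogeneous 1) →
          (∑ i, C (a i) * aeval (m i) (esymm (Fin D) ℂ n)) = perPoly (Fin n) ℂ →
            2 ^ n ≤ r * (D + 1) * (D + 1) * (n + 2) ^ c :=
  ryserOptimal_imp_esymBound h

/-- Flattening frontier in the heart's model (p150629): the heart's conclusion holds for
`D ≤ n + t⌊log₂(n+2)⌋`, for plain (degree-`n`) e-representations already. [cite: NisanWigderson1996, §3] -/
theorem esymLowDegree :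
    ∀ t : ℕ, ∃ c : ℕ, ∀ n : ℕ, 1 ≤ n →
      ∀ (r D : ℕ) (a : Fin r → ℂ) (m : Fin r → Fin D → MvPolynomial (Fin n × Fin n) ℂ),
        (∀ i j, (m i j).IsHomogeneous 1) →
          (∑ i, C (a i) * aeval (m i) (esymm (Fin D) ℂ n)) = perPoly (Fin n) ℂ →
            D ≤ n + t * Nat.log 2 (n + 2) → 2 ^ n ≤ r * (D + 1) * (n + 2) ^ c :=
  stub_esymLowDegree

/-! ## §3 Composition (sorry-free) and its converse -/

/-- **The line closes the crux**: flattening regime (F, landed) + graded normal form (G, landed) + the heart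
give `SummationBits.RyserOptimalDepth3` BY NAME, with exponent `c₁ + c₂` (`c₁` from the heart, `c₂ = c(t)`
from F at the `t` of the heart), by cases on the degree dial `D ≤ n + t⌊log₂(n+2)⌋`. -/
theorem RyserOptimalDepth3_of :
    Sig.stub_gradedHighDegree →
      Summit.ValiantsHypothesis.ValiantsHypothesis.Theses.SummationBits.RyserOptimalDepth3 := by
  intro hH
  have hF : Sig.stub_flatteningRegime := stub_flatteningRegime_holds
  have hG : Sig.gradedNormalForm := gradedNormalForm_holds
  obtain ⟨t, c₁, hH⟩ := hH
  obtain ⟨c₂, hF⟩ := hF t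
  refine ⟨c₁ + c₂, fun n hn r D ℓ hℓ hsum => ?_⟩
  -- enlarging the exponent is harmless (`n + 2 ≥ 1`)
  have hmono : ∀ c : ℕ, c ≤ c₁ + c₂ → 2 ^ n ≤ r * (D + 1) * (n + 2) ^ c →
      2 ^ n ≤ r * (D + 1) * (n + 2) ^ (c₁ + c₂) := fun c hc h =>
    h.trans (Nat.mul_le_mul_left _ (Nat.pow_le_pow_right (by omega) hc))
  by_cases hD : D ≤ n + t * Nat.log 2 (n + 2)
  · -- flattening regime: F at `t`
    exact hmono c₂ (by omega) (hF n hn r D ℓ hℓ hsum hD)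
  · -- interpolation regime: graded elementary-symmetric normal form (G), then the heart
    obtain ⟨u, a, m, hm, hk⟩ := hG n r D ℓ hℓ hsum
    exact hmono c₁ (by omega) (hH n hn r D u a m hm hk (by omega))

/-- THE SKELETON: the crux, modulo exactly the one registered stub (the compiler checks that the `Sig` copy
and the stub statement agree). -/
theorem RyserOptimalDepth3_proof :
    Summit.ValiantsHypothesis.ValiantsHypothesis.Theses.SummationBits.RyserOptimalDepth3 :=
  RyserOptimalDepth3_of stub_gradedHighDegree

/-- **Converse (sorry-free)**: the crux implies the registered stub (with `t = 0`), because a graded e-system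
with parameters `(r, D)` gives back an affine expression with the same `(r, D)`
(`GradedNormalForm.affine_of_gradedESym`, via `ryserOptimal_imp_gradedBound`).  Hence the registered stub is
EQUIVALENT to the crux. [folklore] -/
theorem RyserOptimalDepth3_imp_gradedHighDegree
    (h : Summit.ValiantsHypothesis.ValiantsHypothesis.Theses.SummationBits.RyserOptimalDepth3) :
    Sig.stub_gradedHighDegree := by
  obtain ⟨c, hc⟩ := ryserOptimal_imp_gradedBound h
  exact ⟨0, c, fun n hn r D u a m hm hk _ => hc n hn r D u a m hm hk⟩

/-- The registered stub is the crux, up to bookkeeping. [folklore] -/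
theorem RyserOptimalDepth3_iff_stub :
    Summit.ValiantsHypothesis.ValiantsHypothesis.Theses.SummationBits.RyserOptimalDepth3 ↔
      Sig.stub_gradedHighDegree :=
  ⟨RyserOptimalDepth3_imp_gradedHighDegree, RyserOptimalDepth3_of⟩

-- The old composition through H is `RyserOptimalDepth3_of (gradedHighDegree_of_esymHighDegree hH)`; it is not
-- declared as a theorem here so that the skeleton audit sees exactly one hypothesis shape (the registered stub).

end Summit.ValiantsHypothesis.ValiantsHypothesis.Cruxes.RyserOptimalDepth3.Registered
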